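import Mathlib
import HarnessLib
import Summits.HubbardSuperconductivity.HubbardSuperconductivity.Theorems.KLProgrammeKLRegimeTwoPointAssemblyIntTools
import Summits.HubbardSuperconductivity.HubbardSuperconductivity.Theorems.KLProgrammeKLRegimeTwoPointAssemblyIteratedCauchy

/-!
# Child 4 `KLRegimeTwoPointAssemblyV7` (stmt-HubbardSuperconductivity-19666), stub `stub_asm_int`: under the volume-limit slot
# `FinalTwoLegVolLimit` the interacting part `reprInt` is CAUCHY in the iterated sense (seat hubbard-kl-r2d-p2) — part 2: the stub

`reprInt L M = Σ_n a_{L,M}(n)`, `a_{L,M}(n) = (1/β) L⁻² Σ_{k⃗} e^{ip(x̄−ȳ)} ĝ_K(ω_n,k⃗)² Σ̂_{L,M}((ω_n,k⃗),σ)` over the Matsubara integers `n ∈ [−M, M)`.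
Domination: `|ĝ_K(ω,k⃗)|² ≤ ω⁻² = β²/(π²(2n+1)²)` and `‖Σ̂‖ ≤ B` beyond `(L₀, Mstar)` (VL (i)) give a summable majorant; per `n`,
`a_{L,M}(n)` is within `(β/π²)ε'` of the Riemann sum of the CONTINUOUS `p ↦ e^{ip(x−y)} ĝ_n(p)² Σ∞(n,p,σ)` (VL (ii)), whose Riemann sums
converge (`tendsto_cornerRiemannSum`); the iterated-Cauchy Tannery lemma (`…IteratedCauchy`) assembles.
-/

noncomputable section

namespace Summit.HubbardSuperconductivity.HubbardSuperconductivity.Theorems.TwoPointAssembly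

set_option linter.dupNamespace false -- summit = problem name (single-conjunct summit), D-0017

open Finset Filter Topology MeasureTheory Literature.MathematicalPhysics.QuantumLattice Literature.Probability.LatticeModels
open GrassmannAlgebra Summit.HubbardSuperconductivity.HubbardSuperconductivity.Theorems.KLRegimeSplit
open Summit.HubbardSuperconductivity.HubbardSuperconductivity.Theorems.KLProgrammeLegKernels

/-! ## §3 The interacting part as a Matsubara sum, and the `ℤ`-indexed family `intA` -/

section Model

variable {L : ℕ} [NeZero L]

omit [NeZero L] in
/-- `‖e^{ip·(x̄−ȳ)}‖ = 1`. -/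
theorem norm_sitePhase (k xe ye : TorusSite 2 L) : ‖sitePhase L k xe ye‖ = 1 := by
  rw [sitePhase, mul_comm, Complex.norm_exp_ofReal_mul_I]

/-- The term of the interacting part at the frequency label `ω`:
`(1/β) L⁻² Σ_{k⃗} e^{ip(x̄−ȳ)} ĝ_K(ω,k⃗)² Σ̂_{L,M}((ω,k⃗),σ)`. -/
def intTerm (L M : ℕ) [NeZero L] (β U μ : ℝ) (K : TrigPolyC4v) (σ : Fin 2) (x y : Site 2) (ω : MatsubaraIdx M) : ℂ :=
  (1 / (β : ℂ)) * ((((L : ℝ) ^ 2 : ℝ) : ℂ)⁻¹ * ∑ k : TorusSite 2 L,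
    sitePhase L k (Torus.proj L x) (Torus.proj L y) * propCT L M β μ K (ω, k) ^ 2 *
      selfEnergy L M β (fullActionCT L M β U μ K) (ω, k) σ)

/-- The interacting part is the Matsubara sum of its terms. -/
theorem reprInt_eq_sum_intTerm (M : ℕ) {β : ℝ} (hβ : β ≠ 0) (U μ : ℝ) (K : TrigPolyC4v) (σ : Fin 2) (x y : Site 2) :
    reprInt L M β U μ K σ σ (Torus.proj L x) (Torus.proj L y) = ∑ ω : MatsubaraIdx M, intTerm L M β U μ K σ x y ω := by
  rw [reprInt, if_pos rfl, Fintype.sum_prod_type, div_eq_inv_mul, Finset.mul_sum]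
  have hL : ((L : ℝ) : ℂ) ≠ 0 := by exact_mod_cast NeZero.ne L
  have hβ' : (β : ℂ) ≠ 0 := by exact_mod_cast hβ
  refine Finset.sum_congr rfl fun ω _ => ?_
  rw [intTerm, Finset.mul_sum, Finset.mul_sum, Finset.mul_sum]
  refine Finset.sum_congr rfl fun k _ => ?_
  push_cast
  field_simp

/-- **The `ℤ`-indexed family**: `intA … L M n` = the term of the Matsubara integer `n` when `L ≠ 0` and `n ∈ [−M, M)`, else `0`. -/
def intA (β U μ : ℝ) (K : TrigPolyC4v) (σ : Fin 2) (x y : Site 2) (L M : ℕ) (n : ℤ) : ℂ :=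
  if h : L ≠ 0 ∧ (-(M : ℤ) ≤ n ∧ n < M) then
    haveI : NeZero L := ⟨h.1⟩
    intTerm L M β U μ K σ x y (idxOfInt M n h.2)
  else 0

/-- Within range, `intA` is the term of the corresponding label. -/
theorem intA_of_mem (β U μ : ℝ) (K : TrigPolyC4v) (σ : Fin 2) (x y : Site 2) (M : ℕ) {n : ℤ}
    (hn : -(M : ℤ) ≤ n ∧ n < M) : intA β U μ K σ x y L M n = intTerm L M β U μ K σ x y (idxOfInt M n hn) := by
  rw [intA, dif_pos ⟨NeZero.ne L, hn⟩]

omit [NeZero L] in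
/-- Out of range, `intA` vanishes. -/
theorem intA_of_not_mem (β U μ : ℝ) (K : TrigPolyC4v) (σ : Fin 2) (x y : Site 2) (M : ℕ) {n : ℤ}
    (hn : ¬(-(M : ℤ) ≤ n ∧ n < M)) : intA β U μ K σ x y L M n = 0 := by
  rw [intA, dif_neg (fun h => hn h.2)]

/-- **The interacting part is the sum of the family over `ℤ`.** -/
theorem reprInt_eq_tsum_intA (M : ℕ) {β : ℝ} (hβ : β ≠ 0) (U μ : ℝ) (K : TrigPolyC4v) (σ : Fin 2) (x y : Site 2) :
    reprInt L M β U μ K σ σ (Torus.proj L x) (Torus.proj L y) = ∑' n : ℤ, intA β U μ K σ x y L M n := by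
  classical
  rw [reprInt_eq_sum_intTerm M hβ, tsum_eq_sum (s := Finset.univ.image (matsubaraInt M))]
  · rw [Finset.sum_image fun i _ j _ h => matsubaraInt_injective M h]
    refine Finset.sum_congr rfl fun ω _ => ?_
    rw [intA_of_mem β U μ K σ x y M (matsubaraInt_mem M ω), idxOfInt_matsubaraInt]
  · intro n hn
    apply intA_of_not_mem
    intro hmem
    exact hn (Finset.mem_image.2 ⟨idxOfInt M n hmem, Finset.mem_univ _, matsubaraInt_idxOfInt M n hmem⟩)

/-- **Norm bound of one term**: `‖intTerm ω‖ ≤ (S/β)·(1/|ω|)²` whenever `‖Σ̂((ω,k⃗),σ)‖ ≤ S` for all `k⃗`. -/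
theorem norm_intTerm_le (M : ℕ) {β : ℝ} (hβ : 0 < β) (U μ : ℝ) (K : TrigPolyC4v) (σ : Fin 2) (x y : Site 2)
    (ω : MatsubaraIdx M) {S : ℝ} (hS : ∀ k : TorusSite 2 L, ‖selfEnergy L M β (fullActionCT L M β U μ K) (ω, k) σ‖ ≤ S) :
    ‖intTerm L M β U μ K σ x y ω‖ ≤ S / β * (1 / |matsubaraFreq β M ω|) ^ 2 := by
  have hL : (0 : ℝ) < (L : ℝ) ^ 2 := by have := NeZero.ne L; positivity
  have hS0 : 0 ≤ S := (norm_nonneg _).trans (hS 0)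
  have hterm : ∀ k : TorusSite 2 L, ‖sitePhase L k (Torus.proj L x) (Torus.proj L y) * propCT L M β μ K (ω, k) ^ 2 *
      selfEnergy L M β (fullActionCT L M β U μ K) (ω, k) σ‖ ≤ (1 / |matsubaraFreq β M ω|) ^ 2 * S := by
    intro k
    rw [norm_mul, norm_mul, norm_sitePhase, one_mul, norm_pow]
    refine mul_le_mul ?_ (hS k) (norm_nonneg _) (by positivity)
    rw [propCT_eq_propInt, matsubaraFreq_eq_freqOfInt]
    exact norm_propInt_sq_le hβ.ne' μ K _ _
  rw [intTerm, norm_mul, norm_mul, norm_inv]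
  have h1 : ‖(1 : ℂ) / (β : ℂ)‖ = 1 / β := by
    rw [norm_div, norm_one, Complex.norm_real, Real.norm_eq_abs, abs_of_pos hβ]
  have h2 : ‖((((L : ℝ) ^ 2 : ℝ) : ℂ))‖ = (L : ℝ) ^ 2 := by
    rw [Complex.norm_real, Real.norm_eq_abs, abs_of_pos hL]
  rw [h1, h2]
  calc 1 / β * (((L : ℝ) ^ 2)⁻¹ * ‖∑ k : TorusSite 2 L, sitePhase L k (Torus.proj L x) (Torus.proj L y) *
        propCT L M β μ K (ω, k) ^ 2 * selfEnergy L M β (fullActionCT L M β U μ K) (ω, k) σ‖)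
      ≤ 1 / β * (((L : ℝ) ^ 2)⁻¹ * ∑ k : TorusSite 2 L, (1 / |matsubaraFreq β M ω|) ^ 2 * S) := by
        gcongr
        exact (norm_sum_le _ _).trans (Finset.sum_le_sum fun k _ => hterm k)
    _ = S / β * (1 / |matsubaraFreq β M ω|) ^ 2 := by
        rw [Finset.sum_const, Finset.card_univ, card_torusSite, nsmul_eq_mul]
        have hL' : (L : ℝ) ≠ 0 := by exact_mod_cast NeZero.ne L
        push_cast
        field_simp

end Model

/-! ## §4 Domination and termwise Cauchy of `intA` under the volume-limit slot -/

section Slot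

variable {β U μ : ℝ} {K : TrigPolyC4v} {Mstar : ℕ → ℕ}

/-- The carrier of the slot is the fully integrated action: `klSelfEnergy … (nScales β + 1) = selfEnergy (fullActionCT …)`. -/
theorem klSelfEnergy_nScales_succ (L M : ℕ) [NeZero L] (hβ : 0 < β) (U μ : ℝ) (K : TrigPolyC4v) (k : FreqMomentum L M)
    (σ : Fin 2) :
    klSelfEnergy L M β U μ K klE0 (nScales β + 1) k σ = selfEnergy L M β (fullActionCT L M β U μ K) k σ := by
  rw [klSelfEnergy, klEffectiveAction_nScales_succ L M hβ U μ K, fullActionCT]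

/-- `(1/|ω_n|)² = (β/π)² / (2n+1)²`. -/
theorem one_div_abs_freqOfInt_sq (hβ : 0 < β) (n : ℤ) :
    (1 / |freqOfInt β n|) ^ 2 = (β / Real.pi) ^ 2 * (1 / (2 * (n : ℝ) + 1) ^ 2) := by
  rw [freqOfInt, abs_div, abs_mul, abs_of_pos Real.pi_pos, abs_of_pos hβ]
  rw [show (1 / (Real.pi * |2 * (n : ℝ) + 1| / β)) = (β / Real.pi) * (1 / |2 * (n : ℝ) + 1|) by
    field_simp]
  rw [mul_pow, one_div, inv_pow, sq_abs, one_div]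

/-- **Domination**: beyond `(max L₀ 1, max (Mstar L) 1)` every `intA … L M n` is bounded by the summable
`(B/β)(1/|ω_n|)²`, `B` the slot's uniform bound. -/
theorem intA_dominated (hβ : 0 < β) {B : ℝ} {L₀ : ℕ}
    (hbound : ∀ (L : ℕ) [NeZero L], L₀ ≤ L → ∀ (M : ℕ) [NeZero M], Mstar L ≤ M →
      ∀ (k : FreqMomentum L M) (σ : Fin 2), ‖klSelfEnergy L M β U μ K klE0 (nScales β + 1) k σ‖ ≤ B)
    (σ : Fin 2) (x y : Site 2) :
    ∀ L, max L₀ 1 ≤ L → ∀ M, max (Mstar L) 1 ≤ M → ∀ n : ℤ,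
      ‖intA β U μ K σ x y L M n‖ ≤ B / β * (1 / |freqOfInt β n|) ^ 2 := by
  intro L hL M hM n
  haveI : NeZero L := ⟨by have := le_of_max_le_right hL; omega⟩
  haveI : NeZero M := ⟨by have := le_of_max_le_right hM; omega⟩
  have hB : ∀ (k : FreqMomentum L M), ‖selfEnergy L M β (fullActionCT L M β U μ K) k σ‖ ≤ B := fun k => by
    rw [← klSelfEnergy_nScales_succ L M hβ]; exact hbound L (le_of_max_le_left hL) M (le_of_max_le_left hM) k σ
  by_cases hn : -(M : ℤ) ≤ n ∧ n < M
  · rw [intA_of_mem β U μ K σ x y M hn]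
    have h := norm_intTerm_le M hβ U μ K σ x y (idxOfInt M n hn) (fun k => hB (idxOfInt M n hn, k))
    rwa [matsubaraFreq_eq_freqOfInt, matsubaraInt_idxOfInt] at h
  · rw [intA_of_not_mem β U μ K σ x y M hn, norm_zero]
    have hB0 : 0 ≤ B := (norm_nonneg _).trans (hB (idxOfInt M 0 ⟨by simp, by have := NeZero.pos M; omega⟩, 0))
    positivity

/-- The continuum integrand at the Matsubara integer `n`: `G_n(p) = e^{ip·(x−y)} g_n(p)² Σ∞(n,p,σ)`. -/
def intIntegrand (β μ : ℝ) (K : TrigPolyC4v) (sigmaInf : ℤ → (Fin 2 → ℝ) → Fin 2 → ℂ) (σ : Fin 2) (z : Site 2) (n : ℤ)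
    (p : Fin 2 → ℝ) : ℂ :=
  Complex.exp (Complex.I * ((∑ i, p i * (z i : ℝ) : ℝ) : ℂ)) * propInt β μ K n p ^ 2 * sigmaInf n p σ

/-- Continuity of `G_n` when `Σ∞(n,·,σ)` is continuous. -/
theorem continuous_intIntegrand (hβ : β ≠ 0) (μ : ℝ) (K : TrigPolyC4v) {sigmaInf : ℤ → (Fin 2 → ℝ) → Fin 2 → ℂ}
    (σ : Fin 2) (z : Site 2) (n : ℤ) (hcont : Continuous fun p : Fin 2 → ℝ => sigmaInf n p σ) :
    Continuous (intIntegrand β μ K sigmaInf σ z n) := by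
  unfold intIntegrand
  have h1 : Continuous fun p : Fin 2 → ℝ => ((∑ i, p i * (z i : ℝ) : ℝ) : ℂ) :=
    Complex.continuous_ofReal.comp (by fun_prop)
  exact ((Complex.continuous_exp.comp (continuous_const.mul h1)).mul ((continuous_propInt hβ μ K n).pow 2)).mul hcont

/-- The Riemann sum of `G_n` at side `L`, with the `(1/β)(2π)⁻²` normalisation. -/
def intRiemann (β μ : ℝ) (K : TrigPolyC4v) (sigmaInf : ℤ → (Fin 2 → ℝ) → Fin 2 → ℂ) (σ : Fin 2) (z : Site 2) (n : ℤ)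
    (L : ℕ) : ℂ :=
  (1 / (β : ℂ)) * ((((2 * Real.pi) ^ 2 : ℝ) : ℂ)⁻¹ * cornerRiemannSum (fun q => intIntegrand β μ K sigmaInf σ z n (q + fun _ => Real.pi)) L)

/-- **Grid closeness**: if `Σ̂_{L,M}` is within `ε` of `Σ∞` on the grid at the integer `n`, then `intA … L M n` is within
`(1/β)(1/|ω_n|)²·ε` of the Riemann sum of `G_n`. -/
theorem norm_intA_sub_intRiemann_le {L : ℕ} [NeZero L] (M : ℕ) [NeZero M] (hβ : 0 < β)
    {sigmaInf : ℤ → (Fin 2 → ℝ) → Fin 2 → ℂ} (σ : Fin 2) (x y : Site 2) {n : ℤ} (hn : -(M : ℤ) ≤ n ∧ n < M) {ε : ℝ}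
    (hclose : ∀ k : TorusSite 2 L, ‖selfEnergy L M β (fullActionCT L M β U μ K) (idxOfInt M n hn, k) σ -
      sigmaInf n (latticeMomentum L k) σ‖ ≤ ε) :
    ‖intA β U μ K σ x y L M n - intRiemann β μ K sigmaInf σ (x - y) n L‖ ≤ 1 / β * (1 / |freqOfInt β n|) ^ 2 * ε := by
  have hL : (0 : ℝ) < (L : ℝ) ^ 2 := by have := NeZero.ne L; positivity
  rw [intA_of_mem β U μ K σ x y M hn, intRiemann, ← avg_eq_cornerRiemannSum, intTerm, ← mul_sub, ← mul_sub,
    ← Finset.sum_sub_distrib]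
  have hterm : ∀ k : TorusSite 2 L,
      ‖sitePhase L k (Torus.proj L x) (Torus.proj L y) * propCT L M β μ K (idxOfInt M n hn, k) ^ 2 *
          selfEnergy L M β (fullActionCT L M β U μ K) (idxOfInt M n hn, k) σ -
        intIntegrand β μ K sigmaInf σ (x - y) n (latticeMomentum L k)‖ ≤ (1 / |freqOfInt β n|) ^ 2 * ε := by
    intro k
    rw [intIntegrand, ← sitePhase_proj, propCT_eq_propInt, matsubaraInt_idxOfInt, ← mul_sub, norm_mul, norm_mul,
      norm_sitePhase, one_mul, norm_pow]
    exact mul_le_mul (norm_propInt_sq_le hβ.ne' μ K n _) (hclose k) (norm_nonneg _) (by positivity)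
  have h1 : ‖(1 : ℂ) / (β : ℂ)‖ = 1 / β := by
    rw [norm_div, norm_one, Complex.norm_real, Real.norm_eq_abs, abs_of_pos hβ]
  have h2 : ‖((((L : ℝ) ^ 2 : ℝ) : ℂ))‖ = (L : ℝ) ^ 2 := by
    rw [Complex.norm_real, Real.norm_eq_abs, abs_of_pos hL]
  rw [norm_mul, norm_mul, norm_inv, h1, h2]
  calc 1 / β * (((L : ℝ) ^ 2)⁻¹ * ‖∑ k : TorusSite 2 L, (sitePhase L k (Torus.proj L x) (Torus.proj L y) *
        propCT L M β μ K (idxOfInt M n hn, k) ^ 2 * selfEnergy L M β (fullActionCT L M β U μ K) (idxOfInt M n hn, k) σ -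
          intIntegrand β μ K sigmaInf σ (x - y) n (latticeMomentum L k))‖)
      ≤ 1 / β * (((L : ℝ) ^ 2)⁻¹ * ∑ k : TorusSite 2 L, (1 / |freqOfInt β n|) ^ 2 * ε) := by
        gcongr
        exact (norm_sum_le _ _).trans (Finset.sum_le_sum fun k _ => hterm k)
    _ = 1 / β * (1 / |freqOfInt β n|) ^ 2 * ε := by
        rw [Finset.sum_const, Finset.card_univ, card_torusSite, nsmul_eq_mul]
        have hL' : (L : ℝ) ≠ 0 := by exact_mod_cast NeZero.ne L
        push_cast
        field_simp

/-- **Termwise iterated Cauchy** of `intA` under the slot. -/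
theorem intA_cauchy (hβ : 0 < β) {sigmaInf : ℤ → (Fin 2 → ℝ) → Fin 2 → ℂ}
    (hcont : ∀ (n : ℤ) (σ : Fin 2), Continuous fun p : Fin 2 → ℝ => sigmaInf n p σ)
    (hconv : ∀ (n : ℤ) (σ : Fin 2) (ε : ℝ), 0 < ε → ∃ L₁ : ℕ, ∀ (L : ℕ) [NeZero L], L₁ ≤ L →
      ∃ M₁ : ℕ, ∀ (M : ℕ) [NeZero M], M₁ ≤ M → ∀ ω : MatsubaraIdx M, matsubaraInt M ω = n →
        ∀ k : TorusSite 2 L,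
          ‖klSelfEnergy L M β U μ K klE0 (nScales β + 1) (ω, k) σ - sigmaInf n (latticeMomentum L k) σ‖ ≤ ε)
    (σ : Fin 2) (x y : Site 2) (n : ℤ) (ε : ℝ) (hε : 0 < ε) :
    ∃ L₁ : ℕ, ∀ L L', L₁ ≤ L → L₁ ≤ L' → ∃ M₁ : ℕ, ∀ M M', M₁ ≤ M → M₁ ≤ M' →
      ‖intA β U μ K σ x y L M n - intA β U μ K σ x y L' M' n‖ ≤ ε := by
  -- the constant of the grid-closeness estimate and the working tolerance
  set c : ℝ := 1 / β * (1 / |freqOfInt β n|) ^ 2 with hc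
  have hc0 : 0 ≤ c := by positivity
  set ε' : ℝ := ε / (2 * c + 1) with hε'
  have hε'0 : 0 < ε' := by positivity
  -- grid convergence thresholds
  obtain ⟨L₁c, hL₁c⟩ := hconv n σ ε' hε'0
  -- Riemann sums are Cauchy
  have hR : CauchySeq (intRiemann β μ K sigmaInf σ (x - y) n) := by
    refine Filter.Tendsto.cauchySeq (x := (1 / (β : ℂ)) * ((((2 * Real.pi) ^ 2 : ℝ) : ℂ)⁻¹ *
      ∫ q in brillouin 2, intIntegrand β μ K sigmaInf σ (x - y) n (q + fun _ => Real.pi))) ?_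
    exact (Tendsto.const_mul _ (tendsto_cornerRiemannSum
      (((continuous_intIntegrand hβ.ne' μ K σ (x - y) n (hcont n σ)).comp
        (continuous_id.add continuous_const)).continuousOn))).const_mul _
  rw [Metric.cauchySeq_iff] at hR
  obtain ⟨Nr, hNr⟩ := hR ε' hε'0
  refine ⟨max (max L₁c Nr) 1, fun L L' hL hL' => ?_⟩
  haveI : NeZero L := ⟨by have := le_of_max_le_right hL; omega⟩
  haveI : NeZero L' := ⟨by have := le_of_max_le_right hL'; omega⟩
  obtain ⟨M₁, hM₁⟩ := hL₁c L ((le_max_left _ _).trans (le_of_max_le_left hL))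
  obtain ⟨M₁', hM₁'⟩ := hL₁c L' ((le_max_left _ _).trans (le_of_max_le_left hL'))
  refine ⟨max (max M₁ M₁') (n.natAbs + 1), fun M M' hM hM' => ?_⟩
  haveI : NeZero M := ⟨by have := le_of_max_le_right hM; omega⟩
  haveI : NeZero M' := ⟨by have := le_of_max_le_right hM'; omega⟩
  have hnM : -(M : ℤ) ≤ n ∧ n < M := by have := le_of_max_le_right hM; omega
  have hnM' : -(M' : ℤ) ≤ n ∧ n < M' := by have := le_of_max_le_right hM'; omega
  -- grid closeness at both volumes
  have hA : ‖intA β U μ K σ x y L M n - intRiemann β μ K sigmaInf σ (x - y) n L‖ ≤ c * ε' := by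
    refine norm_intA_sub_intRiemann_le M hβ σ x y hnM fun k => ?_
    rw [← klSelfEnergy_nScales_succ L M hβ]
    exact hM₁ M ((le_max_left _ _).trans (le_of_max_le_left hM)) _ (matsubaraInt_idxOfInt M n hnM) k
  have hA' : ‖intA β U μ K σ x y L' M' n - intRiemann β μ K sigmaInf σ (x - y) n L'‖ ≤ c * ε' := by
    refine norm_intA_sub_intRiemann_le M' hβ σ x y hnM' fun k => ?_
    rw [← klSelfEnergy_nScales_succ L' M' hβ]
    exact hM₁' M' ((le_max_right _ _).trans (le_of_max_le_left hM')) _ (matsubaraInt_idxOfInt M' n hnM') k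
  have hRR : ‖intRiemann β μ K sigmaInf σ (x - y) n L - intRiemann β μ K sigmaInf σ (x - y) n L'‖ ≤ ε' := by
    rw [← dist_eq_norm]
    exact (hNr L ((le_max_right _ _).trans (le_of_max_le_left hL)) L' ((le_max_right _ _).trans (le_of_max_le_left hL'))).le
  calc ‖intA β U μ K σ x y L M n - intA β U μ K σ x y L' M' n‖
      = ‖(intA β U μ K σ x y L M n - intRiemann β μ K sigmaInf σ (x - y) n L) +
          (intRiemann β μ K sigmaInf σ (x - y) n L - intRiemann β μ K sigmaInf σ (x - y) n L') -
          (intA β U μ K σ x y L' M' n - intRiemann β μ K sigmaInf σ (x - y) n L')‖ := by congr 1; ring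
    _ ≤ c * ε' + ε' + c * ε' := by
        refine (norm_sub_le _ _).trans (add_le_add ((norm_add_le _ _).trans (add_le_add hA hRR)) hA')
    _ = ε := by rw [hε']; field_simp; ring

end Slot

/-! ## §5 The stub -/

/-- **`stub_asm_int`** (registered signature of the V7-cut skeleton on stmt-HubbardSuperconductivity-19666). -/
theorem stub_asm_int : ∀ (β : ℝ), 0 < β → ∀ (U μ : ℝ) (K : TrigPolyC4v) (Mstar : ℕ → ℕ),
    FinalTwoLegVolLimit β U μ K Mstar → ∀ (σ σ' : Fin 2) (x y : Site 2) (ε : ℝ), 0 < ε →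
      ∃ L₁ : ℕ, ∀ (L L' : ℕ) [NeZero L] [NeZero L'], L₁ ≤ L → L₁ ≤ L' →
        ∃ M₁ : ℕ, ∀ (M M' : ℕ) [NeZero M] [NeZero M'], M₁ ≤ M → M₁ ≤ M' →
          ‖reprInt L M β U μ K σ σ' (Torus.proj L x) (Torus.proj L y) -
              reprInt L' M' β U μ K σ σ' (Torus.proj L' x) (Torus.proj L' y)‖ ≤ ε := by
  intro β hβ U μ K Mstar hVL σ σ' x y ε hε
  by_cases hσ : σ = σ'
  · subst hσ
    obtain ⟨sigmaInf, B, L₀, hcont, hbound, hconv⟩ := hVL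
    have hb : Summable fun n : ℤ => B / β * (1 / |freqOfInt β n|) ^ 2 := by
      simp only [one_div_abs_freqOfInt_sq hβ, ← mul_assoc]
      exact summable_one_div_two_mul_add_one_sq.mul_left _
    obtain ⟨L₁, hL₁⟩ := iteratedCauchy_tsum hb (intA_dominated hβ hbound σ x y)
      (intA_cauchy hβ hcont hconv σ x y) ε hε
    refine ⟨L₁, fun L L' _ _ hL hL' => ?_⟩
    obtain ⟨M₁, hM₁⟩ := hL₁ L L' hL hL'
    refine ⟨M₁, fun M M' _ _ hM hM' => ?_⟩
    rw [reprInt_eq_tsum_intA M hβ.ne', reprInt_eq_tsum_intA M' hβ.ne']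
    exact hM₁ M M' hM hM'
  · refine ⟨0, fun L L' _ _ _ _ => ⟨0, fun M M' _ _ _ _ => ?_⟩⟩
    rw [reprInt_of_ne L M β U μ K hσ, reprInt_of_ne L' M' β U μ K hσ, sub_zero, norm_zero]
    exact hε.le

end Summit.HubbardSuperconductivity.HubbardSuperconductivity.Theorems.TwoPointAssembly

end
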